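import Literature.IUT.LogVolume.TorsionUnits
import Literature.IUT.LogVolume.UnitLogKernel
import HarnessLib

/-!
# `𝒪_K^× / (𝒪_K^×)^M` is finite for a mixed-characteristic nonarchimedean local field `K`

Classical local-field fact (J. Neukirch, *Algebraic Number Theory*, Ch. II (5.7) (i): for a `𝔭`-adic
number field `K`, `U = 𝒪_K^× ≅ μ_{q−1} × ℤ/p^aℤ × ℤ_p^d`, so `U/U^M` is finite for every `M ≥ 1`)
[cite: NeukirchANT1999, Ch. II (5.7)], in the cell's norm-side MLF setting
(`[NontriviallyNormedField K] [NormedAlgebra ℚ_[p] K] [IsUltrametricDist K] [ProperSpace K]`, e.g. every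
finite `k ⊆ ℚ̄_p`, `PadicSubfields.setting_subfield`), PROVED here WITHOUT the structure theorem, from the
campaign-S `p`-adic logarithm (abc-iut-S1, `LocalUnitLog.lean`): `log_p(𝒪_K^×)` is compact
(`isCompact_logUnits`) and contains a ball (`closedBall_subset_logUnits`), so `M · log_p(𝒪_K^×)` is an open
subgroup of it, of finite index by compactness; and the kernel of `log_p` on units is the (finite,
`finite_torsionUnits`) group of roots of unity (`unitLog_eq_zero_iff`). Stated definition-free, as the
existence of a FINITE set of representatives:

* `exists_finset_units_eq_mul_pow` — for `M ≥ 1` there is a finite set `S` of units (`‖s‖ = 1`) such that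
  every unit `u` is `s · v^M` for some `s ∈ S` and some unit `v`.

Used by the abc-iut cell (layer L6, node IUTchII:Prop2.2(ii), abc-iut-w5-d187) to bound the Kummer classes of
`𝒪^×_K̈` modulo `M` in [EtTh] Prop. 1.5 (iii). Proof-only, no definitions, nothing disputed.
-/

noncomputable section

open Filter Metric Set
open _root_.Topology
open IsUltrametricDist

namespace Literature.IUT.LogVolume

open Literature.NumberTheory.Transcendental

variable (p : ℕ) [Fact p.Prime]
variable (K : Type*) [NontriviallyNormedField K] [instK : NormedAlgebra ℚ_[p] K] [IsUltrametricDist K]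
  [ProperSpace K]
include instK

/-- The `M`-multiples of `log_p(𝒪_K^×)` contain a ball around `0`: if `‖z‖ ≤ ‖M‖ · p⁻²` then
`z = M · log_p v` for some unit `v` (`M ≥ 1`; characteristic `0`). [cite: NeukirchANT1999, Ch. II (5.7)] -/
theorem exists_unit_nsmul_unitLog_eq {M : ℕ} (hM : 0 < M) {z : K}
    (hz : ‖z‖ ≤ ‖(M : K)‖ * (p : ℝ) ^ (-(2 : ℝ))) :
    ∃ v : K, ‖v‖ = 1 ∧ (M : K) * unitLog v = z := by
  haveI := IwasawaLog.charZero p (F := K)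
  have hM0 : (M : K) ≠ 0 := by exact_mod_cast hM.ne'
  have hMn : 0 < ‖(M : K)‖ := norm_pos_iff.mpr hM0
  have hw : ‖(M : K)⁻¹ * z‖ ≤ (p : ℝ) ^ (-(2 : ℝ)) := by
    rw [norm_mul, norm_inv]
    rw [inv_mul_le_iff₀ hMn]
    exact hz
  obtain ⟨v, hv, hvz⟩ := (mem_logUnits_iff).mp (closedBall_subset_logUnits p K hw)
  exact ⟨v, hv, by rw [hvz, mul_inv_cancel_left₀ hM0]⟩

/-- **`𝒪_K^×/(𝒪_K^×)^M` is finite** (Neukirch ANT II (5.7) (i)), definition-free form: for `M ≥ 1` there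
is a finite set `S` of units such that every unit is `s · v^M` with `s ∈ S` and `v` a unit. Proof:
finitely many translates of the open subgroup `M · log_p(𝒪^×)` cover the compact `log_p(𝒪^×)`; lift the
translation vectors to units `s_t`; the discrepancy `u · (s_t v^M)⁻¹` has `log_p = 0`, so is a root of
unity, of which there are finitely many. [cite: NeukirchANT1999, Ch. II (5.7)] -/
theorem exists_finset_units_eq_mul_pow {M : ℕ} (hM : 0 < M) :
    ∃ S : Finset K, (∀ s ∈ S, ‖s‖ = 1) ∧
      ∀ u : K, ‖u‖ = 1 → ∃ s ∈ S, ∃ v : K, ‖v‖ = 1 ∧ u = s * v ^ M := by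
  classical
  haveI := IwasawaLog.charZero p (F := K)
  have hM0 : (M : K) ≠ 0 := by exact_mod_cast hM.ne'
  have hMn : 0 < ‖(M : K)‖ := norm_pos_iff.mpr hM0
  have hp0 : (0 : ℝ) < (p : ℝ) ^ (-(2 : ℝ)) :=
    Real.rpow_pos_of_pos (by exact_mod_cast (Fact.out : p.Prime).pos) _
  -- the "open subgroup" `W = M · log_p(𝒪^×)` as a set, and its translates
  set r : ℝ := ‖(M : K)‖ * (p : ℝ) ^ (-(2 : ℝ)) with hr
  have hr0 : 0 < r := mul_pos hMn hp0
  let U : K → Set K := fun x => {y | ∃ v : K, ‖v‖ = 1 ∧ (M : K) * unitLog v = y - x}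
  have hU : ∀ x ∈ logUnits K, U x ∈ 𝓝 x := by
    intro x _
    rw [Metric.mem_nhds_iff]
    refine ⟨r, hr0, fun y hy => ?_⟩
    rw [Metric.mem_ball, dist_eq_norm] at hy
    exact exists_unit_nsmul_unitLog_eq p K hM hy.le
  obtain ⟨T, hTsub, hTcov⟩ := (isCompact_logUnits p K).elim_nhds_subcover U hU
  -- lift each translation vector `t ∈ T ⊆ log_p(𝒪^×)` to a unit `s t`
  have hlift : ∀ t : K, ∃ s : K, t ∈ logUnits K → ‖s‖ = 1 ∧ unitLog s = t := by
    intro t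
    by_cases ht : t ∈ logUnits K
    · obtain ⟨s, hs, hst⟩ := (mem_logUnits_iff).mp ht
      exact ⟨s, fun _ => ⟨hs, hst⟩⟩
    · exact ⟨1, fun h => (ht h).elim⟩
  choose s hs using hlift
  -- the finitely many roots of unity
  haveI : Finite (torsionUnits K) := finite_torsionUnits p K
  haveI : Fintype (torsionUnits K) := Fintype.ofFinite _
  let emb : ↥(torsionUnits K) → K := fun ζ => ((ζ : Kˣ) : K)
  let Z : Finset K := Finset.image emb (Finset.univ : Finset ↥(torsionUnits K))
  refine ⟨Finset.image (fun q : K × K => s q.1 * q.2) (T ×ˢ Z), ?_, ?_⟩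
  · intro x hx
    obtain ⟨⟨t, z⟩, hq, rfl⟩ := Finset.mem_image.mp hx
    obtain ⟨ht, hz⟩ := Finset.mem_product.mp hq
    obtain ⟨ζ, -, rfl⟩ := Finset.mem_image.mp hz
    have h1 : ‖s t‖ = 1 := (hs t (hTsub t ht)).1
    have h2 : ‖emb ζ‖ = 1 := norm_eq_one_of_mem_torsionUnits K ζ.2
    change ‖s t * emb ζ‖ = 1
    rw [norm_mul, h1, h2, one_mul]
  · intro u hu
    have hlu : unitLog u ∈ logUnits K := unitLog_mem_logUnits hu
    obtain ⟨t, ht, htu⟩ := Set.mem_iUnion₂.mp (hTcov hlu)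
    obtain ⟨v, hv, hvt⟩ := htu
    have hst := hs t (hTsub t ht)
    -- `w := s t * v ^ M` has the same logarithm as `u`
    have hvM : ‖v ^ M‖ = 1 := by rw [norm_pow, hv, one_pow]
    have hw : ‖s t * v ^ M‖ = 1 := by rw [norm_mul, hst.1, hvM, one_mul]
    have hlog : unitLog (s t * v ^ M) = unitLog u := by
      rw [unitLog_mul p hst.1 hvM, unitLog_pow p hv, hst.2, hvt, add_sub_cancel]
    -- so `ζ := u * (s t * v ^ M)⁻¹` is a root of unity
    have hw0 : s t * v ^ M ≠ 0 := norm_pos_iff.mp (by rw [hw]; exact one_pos)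
    have hu0 : u ≠ 0 := norm_pos_iff.mp (by rw [hu]; exact one_pos)
    have hζn : ‖u * (s t * v ^ M)⁻¹‖ = 1 := by rw [norm_mul, norm_inv, hu, hw, inv_one, one_mul]
    have hζlog : unitLog (u * (s t * v ^ M)⁻¹) = 0 := by
      rw [unitLog_mul p hu (by rw [norm_inv, hw, inv_one]), unitLog_inv p hw, hlog, add_neg_cancel]
    obtain ⟨n, hn, hζpow⟩ := (unitLog_eq_zero_iff p K hζn).mp hζlog
    -- package `ζ` as an element of `torsionUnits K`
    let ζu : Kˣ := Units.mk0 (u * (s t * v ^ M)⁻¹) (mul_ne_zero hu0 (inv_ne_zero hw0))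
    have hζu : ζu ∈ torsionUnits K := by
      rw [mem_torsionUnits_iff]
      exact ⟨n, hn, hζpow⟩
    let ζT : ↥(torsionUnits K) := ⟨ζu, hζu⟩
    have hemb : emb ζT = u * (s t * v ^ M)⁻¹ := rfl
    refine ⟨s t * emb ζT, ?_, v, hv, ?_⟩
    · refine Finset.mem_image.mpr ⟨(t, emb ζT), ?_, rfl⟩
      exact Finset.mem_product.mpr ⟨ht, Finset.mem_image.mpr ⟨ζT, Finset.mem_univ _, rfl⟩⟩
    · rw [hemb]
      have : s t * (u * (s t * v ^ M)⁻¹) * v ^ M = u * ((s t * v ^ M)⁻¹ * (s t * v ^ M)) := by ring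
      rw [this, inv_mul_cancel₀ hw0, mul_one]

end Literature.IUT.LogVolume

end
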